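import Mathlib
import Summits.Ventures.FusionMHD.Models.TearingFRS1M4Jets2
import Literature.Analysis.ODE.RegularSingularLogBranchScalar
import Literature.Analysis.ODE.FrobeniusSeriesTruncation
import HarnessLib

/-!
# F3.r3 instance «TearingFRS1.M4» ((4,2) harmonic): Frobenius jets to order 50 and the patch CERTIFIED ON `0 < |x| < 3/10`

Companion of `TearingFRS1M4Jets.lean` and `TearingFRS1M4QDecomp.lean` (operator bounds `‖M_k‖ ≤ 22.91·1.3ᵏ`,
`‖M_k‖ ≤ 4.9·2.5ᵏ`), pattern of `TearingFRS1Jets2.lean` (model-6 g5):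
* `small_val_n`, `reg_val_n` for `25 ≤ n < 50` (exact, kernel-re-derived);
* `small_bound2 : ‖sₙ‖ ≤ (21/20)(5/2)ⁿ`, `reg_bound2 : ‖wₙ‖ ≤ (14/5)·3ⁿ` for ALL `n` — refined jet lemma (jet `n < 30`,
  `c = 1 + (14/5)/30`; thresholds `27.1 ≤ 30` and `78.2 ≤ 84`); the centrifugal term `16k` in `qc` costs the rates `5/2`, `3`;
* `SmallPatchOn`, `LogPatchOn` — the patch-fact bundles of this instance (as in `TearingFRS1Matching.lean`), and
  `smallSol_on_wide`, `logSol_on_wide` on `|x| < 3/10` — the hypotheses of the matching theorem with `δ = 3/10`, `x₀ = 1/4`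
  (tails at `1/4`: `(5/8)ⁿ`, `(3/4)ⁿ`, hence the jets to order 50).
Generated by `HOME/lean/tools/model-6/teargen/gen_jets.py` (exact fractions); nothing is trusted. [instance data]
-/

noncomputable section

open Finset Literature.Analysis.ODE

namespace Summit.Ventures.FusionMHD.Models

namespace TearingFRS1

namespace M4

/-! ### Bounds for all `n` by the refined jet lemma -/

/-- The resolvent factor beyond the jet: `‖Rₙ‖ ≤ (1 + (14/5)/30)/n` for `n ≥ 30`. [instance data] -/
theorem norm_Rsys_le_beyond (n : ℕ) (hn : 30 ≤ n) (_h1 : 1 ≤ n) : ‖M4.Rsys n‖ ≤ (1 + (14 / 5) / 30) / n := by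
  have h := norm_scalarSysR_le_of_le pc M4.qc (N := 30) (by norm_num) hn (by rw [pc_val_0, add_zero, RCLike.norm_natCast])
  rw [qc_val_0] at h
  have e : ‖(-14 / 5 : ℝ)‖ = 14 / 5 := by norm_num
  rw [e] at h
  exact h

/-- THE JET of the small solution at rate `5/2`: `‖sₙ‖ ≤ (21/20)(5/2)ⁿ` for `n < 30`. [instance data] -/
theorem small_jet2 : ∀ n : ℕ, n < 30 →
    ‖frobeniusCoeff M4.Msys (fun _ => 0) M4.Rsys ((0 : ℝ), (1 : ℝ)) n‖ ≤ 21 / 20 * (5 / 2 : ℝ) ^ n := by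
  intro n hn
  interval_cases n
  · rw [small_val_0]; simp only [Prod.norm_mk, Real.norm_eq_abs]; norm_num
  · rw [small_val_1]; simp only [Prod.norm_mk, Real.norm_eq_abs]; norm_num
  · rw [small_val_2]; simp only [Prod.norm_mk, Real.norm_eq_abs]; norm_num
  · rw [small_val_3]; simp only [Prod.norm_mk, Real.norm_eq_abs]; norm_num
  · rw [small_val_4]; simp only [Prod.norm_mk, Real.norm_eq_abs]; norm_num
  · rw [small_val_5]; simp only [Prod.norm_mk, Real.norm_eq_abs]; norm_num
  · rw [small_val_6]; simp only [Prod.norm_mk, Real.norm_eq_abs]; norm_num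
  · rw [small_val_7]; simp only [Prod.norm_mk, Real.norm_eq_abs]; norm_num
  · rw [small_val_8]; simp only [Prod.norm_mk, Real.norm_eq_abs]; norm_num
  · rw [small_val_9]; simp only [Prod.norm_mk, Real.norm_eq_abs]; norm_num
  · rw [small_val_10]; simp only [Prod.norm_mk, Real.norm_eq_abs]; norm_num
  · rw [small_val_11]; simp only [Prod.norm_mk, Real.norm_eq_abs]; norm_num
  · rw [small_val_12]; simp only [Prod.norm_mk, Real.norm_eq_abs]; norm_num
  · rw [small_val_13]; simp only [Prod.norm_mk, Real.norm_eq_abs]; norm_num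
  · rw [small_val_14]; simp only [Prod.norm_mk, Real.norm_eq_abs]; norm_num
  · rw [small_val_15]; simp only [Prod.norm_mk, Real.norm_eq_abs]; norm_num
  · rw [small_val_16]; simp only [Prod.norm_mk, Real.norm_eq_abs]; norm_num
  · rw [small_val_17]; simp only [Prod.norm_mk, Real.norm_eq_abs]; norm_num
  · rw [small_val_18]; simp only [Prod.norm_mk, Real.norm_eq_abs]; norm_num
  · rw [small_val_19]; simp only [Prod.norm_mk, Real.norm_eq_abs]; norm_num
  · rw [small_val_20]; simp only [Prod.norm_mk, Real.norm_eq_abs]; norm_num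
  · rw [small_val_21]; simp only [Prod.norm_mk, Real.norm_eq_abs]; norm_num
  · rw [small_val_22]; simp only [Prod.norm_mk, Real.norm_eq_abs]; norm_num
  · rw [small_val_23]; simp only [Prod.norm_mk, Real.norm_eq_abs]; norm_num
  · rw [small_val_24]; simp only [Prod.norm_mk, Real.norm_eq_abs]; norm_num
  · rw [small_val_25]; simp only [Prod.norm_mk, Real.norm_eq_abs]; norm_num
  · rw [small_val_26]; simp only [Prod.norm_mk, Real.norm_eq_abs]; norm_num
  · rw [small_val_27]; simp only [Prod.norm_mk, Real.norm_eq_abs]; norm_num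
  · rw [small_val_28]; simp only [Prod.norm_mk, Real.norm_eq_abs]; norm_num
  · rw [small_val_29]; simp only [Prod.norm_mk, Real.norm_eq_abs]; norm_num

/-- **ALL coefficients of the small solution** (`m = 4`): `‖sₙ‖ ≤ (21/20)(5/2)ⁿ` (refined jet lemma: `μ = 5/2 > a = 13/10`,
`K = 2291/100`, `c = 1 + (14/5)/30`, threshold `27.1 ≤ 30`). [instance data] -/
theorem small_bound2 (n : ℕ) :
    ‖frobeniusCoeff M4.Msys (fun _ => 0) M4.Rsys ((0 : ℝ), (1 : ℝ)) n‖ ≤ 21 / 20 * (5 / 2 : ℝ) ^ n := by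
  refine norm_frobeniusCoeff_le_of_jet' (N := 30) (a := 13 / 10) (K := 2291 / 100) (G := 0) (c := 1 + (14 / 5) / 30)
    (by norm_num) (by norm_num) le_rfl (by norm_num) norm_Msys_le_sharp (fun k _ => by simp)
    (fun n hn h1 => norm_Rsys_le_beyond n hn h1) (by norm_num) (by simp [Prod.norm_mk]; norm_num) small_jet2 ?_ n
  norm_num

/-- Frobenius data of the regular part at rate `5/2` (the rate of the small-solution bound), `K = 49/10`, `G = (14/5)(21/20)`.
[instance data] -/
theorem regData2 : IsFrobeniusData M4.Msys (logBranchInhom M4.Msys M4.Rsys ((0 : ℝ), (1 : ℝ)) (14 / 5 : ℝ)) M4.Rsys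
    ((1 : ℝ), (14 / 5 : ℝ)) (5 / 2) (49 / 10) (14 / 5 * (21 / 20)) (scalarLogC M4.qc) := by
  have hD := isScalarLogData_wide.small
  exact
  { a_nonneg := by norm_num
    K_nonneg := by norm_num
    G_nonneg := by norm_num
    c_nonneg := hD.c_nonneg
    norm_M_le := norm_Msys_le_two
    norm_g_le := fun k _ => by
      rw [inhom_val, norm_neg, norm_smul]
      have h := small_bound2 k
      have : ‖(14 / 5 : ℝ)‖ = 14 / 5 := by norm_num
      rw [this]
      nlinarith [norm_nonneg (frobeniusCoeff M4.Msys (fun _ => 0) M4.Rsys ((0 : ℝ), (1 : ℝ)) k)]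
    rightInverse := hD.rightInverse
    norm_R_le := hD.norm_R_le
    compat := by
      rw [logBranchInhom_zero]
      ext <;> norm_num [M4.Msys, scalarSysM_apply, pc_val_0, qc_val_0] }

/-- THE JET of the regular part at rate `3`: `‖wₙ‖ ≤ (14/5)3ⁿ` for `n < 30`. [instance data] -/
theorem reg_jet2 : ∀ n : ℕ, n < 30 →
    ‖frobeniusCoeff M4.Msys (logBranchInhom M4.Msys M4.Rsys ((0 : ℝ), (1 : ℝ)) (14 / 5 : ℝ)) M4.Rsys ((1 : ℝ), (14 / 5 : ℝ)) n‖ ≤ 14 / 5 * (3 : ℝ) ^ n := by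
  intro n hn
  interval_cases n
  · rw [reg_val_0]; simp only [Prod.norm_mk, Real.norm_eq_abs]; norm_num
  · rw [reg_val_1]; simp only [Prod.norm_mk, Real.norm_eq_abs]; norm_num
  · rw [reg_val_2]; simp only [Prod.norm_mk, Real.norm_eq_abs]; norm_num
  · rw [reg_val_3]; simp only [Prod.norm_mk, Real.norm_eq_abs]; norm_num
  · rw [reg_val_4]; simp only [Prod.norm_mk, Real.norm_eq_abs]; norm_num
  · rw [reg_val_5]; simp only [Prod.norm_mk, Real.norm_eq_abs]; norm_num
  · rw [reg_val_6]; simp only [Prod.norm_mk, Real.norm_eq_abs]; norm_num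
  · rw [reg_val_7]; simp only [Prod.norm_mk, Real.norm_eq_abs]; norm_num
  · rw [reg_val_8]; simp only [Prod.norm_mk, Real.norm_eq_abs]; norm_num
  · rw [reg_val_9]; simp only [Prod.norm_mk, Real.norm_eq_abs]; norm_num
  · rw [reg_val_10]; simp only [Prod.norm_mk, Real.norm_eq_abs]; norm_num
  · rw [reg_val_11]; simp only [Prod.norm_mk, Real.norm_eq_abs]; norm_num
  · rw [reg_val_12]; simp only [Prod.norm_mk, Real.norm_eq_abs]; norm_num
  · rw [reg_val_13]; simp only [Prod.norm_mk, Real.norm_eq_abs]; norm_num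
  · rw [reg_val_14]; simp only [Prod.norm_mk, Real.norm_eq_abs]; norm_num
  · rw [reg_val_15]; simp only [Prod.norm_mk, Real.norm_eq_abs]; norm_num
  · rw [reg_val_16]; simp only [Prod.norm_mk, Real.norm_eq_abs]; norm_num
  · rw [reg_val_17]; simp only [Prod.norm_mk, Real.norm_eq_abs]; norm_num
  · rw [reg_val_18]; simp only [Prod.norm_mk, Real.norm_eq_abs]; norm_num
  · rw [reg_val_19]; simp only [Prod.norm_mk, Real.norm_eq_abs]; norm_num
  · rw [reg_val_20]; simp only [Prod.norm_mk, Real.norm_eq_abs]; norm_num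
  · rw [reg_val_21]; simp only [Prod.norm_mk, Real.norm_eq_abs]; norm_num
  · rw [reg_val_22]; simp only [Prod.norm_mk, Real.norm_eq_abs]; norm_num
  · rw [reg_val_23]; simp only [Prod.norm_mk, Real.norm_eq_abs]; norm_num
  · rw [reg_val_24]; simp only [Prod.norm_mk, Real.norm_eq_abs]; norm_num
  · rw [reg_val_25]; simp only [Prod.norm_mk, Real.norm_eq_abs]; norm_num
  · rw [reg_val_26]; simp only [Prod.norm_mk, Real.norm_eq_abs]; norm_num
  · rw [reg_val_27]; simp only [Prod.norm_mk, Real.norm_eq_abs]; norm_num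
  · rw [reg_val_28]; simp only [Prod.norm_mk, Real.norm_eq_abs]; norm_num
  · rw [reg_val_29]; simp only [Prod.norm_mk, Real.norm_eq_abs]; norm_num

/-- **ALL coefficients of the regular part** (`m = 4`): `‖wₙ‖ ≤ (14/5)·3ⁿ` (refined jet lemma: `μ = 3 > a = 5/2`,
threshold `78.2 ≤ 84`). [instance data] -/
theorem reg_bound2 (n : ℕ) :
    ‖frobeniusCoeff M4.Msys (logBranchInhom M4.Msys M4.Rsys ((0 : ℝ), (1 : ℝ)) (14 / 5 : ℝ)) M4.Rsys ((1 : ℝ), (14 / 5 : ℝ)) n‖ ≤ 14 / 5 * (3 : ℝ) ^ n := by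
  have hD := regData2
  refine norm_frobeniusCoeff_le_of_jet' (N := 30) (c := 1 + (14 / 5) / 30) hD.a_nonneg hD.K_nonneg hD.G_nonneg
    (by norm_num) hD.norm_M_le hD.norm_g_le (fun n hn h1 => norm_Rsys_le_beyond n hn h1) (by norm_num)
    (by simp [Prod.norm_mk]; norm_num) reg_jet2 ?_ n
  norm_num

/-! ### The patch certified on `|x| < 3/10`, both sides -/

/-- SMALL SOLUTION on `|x| < 3/10`: `(ψ_s, ψ_s′)` differentiable, `ψ_s′` the derivative of `ψ_s`, and the local equation.
[instance data] -/
theorem smallSol_on_wide {x : ℝ} (hx : |x| < 3 / 10) :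
    DifferentiableAt ℝ (scalarSmallSol pc M4.qc) x ∧
      (x ≠ 0 → HasDerivAt (fun z => (scalarSmallSol pc M4.qc z).1) ((scalarSmallSol pc M4.qc x).2) x) ∧
      HasDerivAt (fun z => (scalarSmallSol pc M4.qc z).2) ((deriv (scalarSmallSol pc M4.qc) x).2) x ∧
      x * (deriv (scalarSmallSol pc M4.qc) x).2 + p x * (scalarSmallSol pc M4.qc x).2
        + q x * (scalarSmallSol pc M4.qc x).1 = 0 := by
  have hxn : ‖x‖ < 4 / 5 := by rw [Real.norm_eq_abs]; linarith
  have hxμ : (5 / 2 : ℝ) * ‖x‖ < 1 := by rw [Real.norm_eq_abs]; linarith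
  exact isScalarLogData_wide.smallSol_of_bound small_bound2 (by norm_num) hxn hxμ

/-- LOGARITHMIC BRANCH on `0 < |x| < 3/10`, BOTH SIDES (`ℓ = Real.log`). [instance data] -/
theorem logSol_on_wide {x : ℝ} (hx : |x| < 3 / 10) (hx0 : x ≠ 0) :
    HasDerivAt (fun z => (scalarLogSol pc M4.qc 1 (14 / 5) Real.log z).1) ((scalarLogSol pc M4.qc 1 (14 / 5) Real.log x).2) x ∧
      HasDerivAt (fun z => (scalarLogSol pc M4.qc 1 (14 / 5) Real.log z).2)
        ((deriv (scalarLogSol pc M4.qc 1 (14 / 5) Real.log) x).2) x ∧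
      x * (deriv (scalarLogSol pc M4.qc 1 (14 / 5) Real.log) x).2 + p x * (scalarLogSol pc M4.qc 1 (14 / 5) Real.log x).2
        + q x * (scalarLogSol pc M4.qc 1 (14 / 5) Real.log x).1 = 0 := by
  have hxn : ‖x‖ < 4 / 5 := by rw [Real.norm_eq_abs]; linarith
  have hx2 : (3 : ℝ) * ‖x‖ < 1 := by rw [Real.norm_eq_abs]; linarith
  have hs : ∀ n, ‖frobeniusCoeff (scalarSysM pc M4.qc) (fun _ => 0) (scalarSysR pc M4.qc) ((0 : ℝ), (1 : ℝ)) n‖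
      ≤ 21 / 20 * (3 : ℝ) ^ n := fun n =>
    (small_bound2 n).trans (mul_le_mul_of_nonneg_left (pow_le_pow_left₀ (by norm_num) (by norm_num) n)
      (by norm_num))
  have hk : -(M4.qc 0) * (1 : ℝ) = 14 / 5 := kappa_eq
  have hw : ∀ n, ‖frobeniusCoeff (scalarSysM pc M4.qc)
      (logBranchInhom (scalarSysM pc M4.qc) (scalarSysR pc M4.qc) ((0 : ℝ), (1 : ℝ)) (-(M4.qc 0) * 1))
      (scalarSysR pc M4.qc) ((1 : ℝ), (14 / 5 : ℝ)) n‖ ≤ 14 / 5 * (3 : ℝ) ^ n := by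
    rw [hk]; exact reg_bound2
  exact isScalarLogData_wide.logSol_of_bound 1 (14 / 5) hs hw (by norm_num) hxn hx2 hx0 (Real.hasDerivAt_log hx0)


end M4

end TearingFRS1

end Summit.Ventures.FusionMHD.Models

end
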